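import Literature.Geometry.Lorentzian.TameBreathingCurve
import Literature.Geometry.Lorentzian.CauchyDevelopmentPrecomp
import Literature.Geometry.Lorentzian.AFEndUnbreathe
import Summits.FinalStateConjecture.FinalStateConjecture.Statement
import Summits.FinalStateConjecture.FinalStateConjecture.Theorems.PhaseMixingCaptureCaptureSufficesC2SettlingTransport
import Summits.FinalStateConjecture.FinalStateConjecture.Theorems.SwallowTheDatumParametricKerrBurialLine
import HarnessLib

/-!
# Crux `CensorshipAlongKerrEnds` (stmt-FinalStateConjecture-18521), line `Sketch` v4 (compact-support architecture):
# stub `stub_compactSettledBreathing` — COMPACT SETTLED BREATHING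

Write `Good D` for the per-datum property of the summit statement `FinalStateConjecture` (an MGHD exists; every
MGHD has complete `𝓘⁺` and carries an honest sub-extremal `2`-Kerr final-state decomposition).

**Compact settled breathing.** Through every admissible datum `D₀` with `Good D₀` passes a one-parameter family
`G : ℝ¹ → InitialDataSet (𝓡 3) X`, tame on some asymptotically flat end, immersed at `0`, with `G 0 = D₀`, all of
whose members are admissible AND good, AND which is a COMPACTLY SUPPORTED modification of `D₀`: every member agrees
with `D₀` (metric and second fundamental form, pointwise) off one compact set.

Witness: the breathing curve `c ↦ (breathe (σ (c 0)))^* D₀` of `D₀` on a coordinate ball far out on its sole end,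
exactly as in the landed `stub_settledBreathing` (`Theorems/ExactKerrEndsCensorshipAlongKerrEndsSettledBreathing.lean`,
p148292); the new clause is `AFEnd.breatheFamily_eq_of_not_mem_core` (the breathing diffeomorphisms are the identity
off the compact breathing core `AFEnd.breatheCore`, `AFEnd.isCompact_breatheCore`). This is the compact-support
clause that the v4 architecture of the line consumes (the settled access family must agree with the base datum off
a compact set, so that the glued far field can be taken independent of the parameter).

References: Christodoulou, CQG 16 (1999) A23, p. A24 (genericity by lines `α₀ + c f`, `f` of compact support, in a
fixed space of data); Choquet-Bruhat–Geroch, CMP 14 (1969), p. 330 (diffeomorphism covariance of developments).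
-/

-- the doubled `FinalStateConjecture.FinalStateConjecture` path component trips dupNamespace
set_option linter.dupNamespace false

noncomputable section

open Set Function Filter
open scoped Manifold ContDiff Topology

namespace Summit.FinalStateConjecture.FinalStateConjecture.Theorems.ExactKerrEnds.CensorshipAlongKerrEnds

open Literature.Geometry.Lorentzian
open Summit.FinalStateConjecture.FinalStateConjecture.Theorems.PhaseMixingCaptureCaptureSufficesC2
  (summit_breatheFamily)
open Summit.FinalStateConjecture.FinalStateConjecture.Theorems.SwallowTheDatum.ParametricKerrBurial (AgreeAt)

/-- **Stub `stub_compactSettledBreathing` — COMPACT SETTLED BREATHING.** Through every admissible datum `D₀` all of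
whose maximal vacuum Cauchy developments have complete `𝓘⁺` and settle down (and which has one) passes a family of
initial data, tame on a collared restriction of the sole end of `D₀`, immersed at `0`, through `D₀` at `0`, admissible,
agreeing with `D₀` off the compact breathing core, ALL of whose members have the same property: the breathing curve of
`D₀` (`AFEnd.breatheFamily`), the property being transported along the breathing diffeomorphisms
(`summit_breatheFamily`). [cite: Christodoulou1999, p. A24] -/
theorem stub_compactSettledBreathing : ∀ (X : Type) [TopologicalSpace X] [ChartedSpace Literature.Geometry.Lorentzian.E3 X] [IsManifold (𝓡 3) ((⊤ : ℕ∞) : WithTop ℕ∞) X] [T2Space X] [SecondCountableTopology X] [ConnectedSpace X], ∀ D₀ ∈ Literature.Geometry.Lorentzian.admissibleVacuumData X, ((∃ 𝒟 : Literature.Geometry.Lorentzian.VacuumCauchyDevelopment D₀, 𝒟.IsMaximal) ∧ ∀ 𝒟 : Literature.Geometry.Lorentzian.VacuumCauchyDevelopment D₀, 𝒟.IsMaximal → Summit.FinalStateConjecture.HasCompleteNullInfinity 𝒟.toCauchyDevelopment ∧ ∃ (O : Set 𝒟.carrier) (d : Literature.Geometry.Lorentzian.FinalStateDecomposition 𝒟.toSpacetime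 O 2), (∀ i, Literature.Geometry.Lorentzian.Kerr.IsSubextremal (d.mass i) (d.spin i)) ∧ O = Summit.FinalStateConjecture.exteriorOf 𝒟.toCauchyDevelopment d.charted ∧ Summit.FinalStateConjecture.RaysStayInClosure 𝒟.toCauchyDevelopment O ∧ Summit.FinalStateConjecture.HasExhaustiveCharts d ∧ Summit.FinalStateConjecture.IsFutureOriented d) → ∃ (e : Literature.Geometry.Lorentzian.AFEnd X) (G : EuclideanSpace ℝ (Fin 1) → Literature.Geometry.Lorentzian.InitialDataSet (𝓡 3) X), Literature.Geometry.Lorentzian.InitialDataSet.IsTameDataFamily e 1 G ∧ Literature.Geometry.Lorentzian.InitialDataSet.IsImmersedAtZero 1 G ∧ G 0 = D₀ ∧ (∀ c, G c ∈ Literature.Geometry.Lorentzian.admissibleVacuumData X) ∧ (∃ K : Set X, IsCompact K ∧ ∀ (c : EuclideanSpace ℝ (Fin 1)) (x : X), x ∉ K → Summit.FinalStateConjecture.FinalStateConjecture.Theorems.SwallowTheDatum.ParametricKerrBurial.AgreeAt (G c) D₀ x) ∧ ∀ c, ((∃ 𝒟 : Literature.Geometry.Lorentzian.VacuumCauchyDevelopment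 (G c), 𝒟.IsMaximal) ∧ ∀ 𝒟 : Literature.Geometry.Lorentzian.VacuumCauchyDevelopment (G c), 𝒟.IsMaximal → Summit.FinalStateConjecture.HasCompleteNullInfinity 𝒟.toCauchyDevelopment ∧ ∃ (O : Set 𝒟.carrier) (d : Literature.Geometry.Lorentzian.FinalStateDecomposition 𝒟.toSpacetime O 2), (∀ i, Literature.Geometry.Lorentzian.Kerr.IsSubextremal (d.mass i) (d.spin i)) ∧ O = Summit.FinalStateConjecture.exteriorOf 𝒟.toCauchyDevelopment d.charted ∧ Summit.FinalStateConjecture.RaysStayInClosure 𝒟.toCauchyDevelopment O ∧ Summit.FinalStateConjecture.HasExhaustiveCharts d ∧ Summit.FinalStateConjecture.IsFutureOriented d) := by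
  intro X _ _ _ _ _ _ D₀ hD₀ hS
  obtain ⟨-, e, M, hsole, hdecay⟩ := id hD₀
  -- a breathing ball far out on the sole end of `D₀` (as in `InitialDataSet.exists_tame_selfWitness`)
  set z₀ : E3 := (e.R + 3) • EuclideanSpace.single (0 : Fin 3) (1 : ℝ) with hz₀
  have hz₀n : ‖z₀‖ = e.R + 3 := by
    rw [hz₀, norm_smul, PiLp.norm_single, norm_one, mul_one,
      Real.norm_of_nonneg (by linarith [e.R_pos])]
  have B : e.BreathingData z₀ 1 := ⟨one_pos, by rw [hz₀n]; linarith⟩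
  have hR₁ : e.R < e.R + 1 := by linarith
  exact ⟨e.restrict hR₁.le, fun c ↦ AFEnd.breatheFamily B D₀ (c 0),
    AFEnd.isTameDataFamily_restrict_breatheCurve B D₀ hsole hdecay hR₁,
    AFEnd.isImmersedAtZero_breatheCurve B D₀, AFEnd.breatheCurve_zero B D₀,
    fun c ↦ AFEnd.breatheCurve_mem_admissibleVacuumData B D₀ hD₀ c,
    ⟨AFEnd.breatheCore e z₀ 1, AFEnd.isCompact_breatheCore B,
      fun c x hx ↦ AFEnd.breatheFamily_eq_of_not_mem_core B D₀ (c 0) hx⟩,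
    fun c ↦ summit_breatheFamily B D₀ (c 0) hS⟩

end Summit.FinalStateConjecture.FinalStateConjecture.Theorems.ExactKerrEnds.CensorshipAlongKerrEnds

end
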